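import Literature.NumberTheory.EllipticCurves.LocalPointsModKernelOfReductionMultiplicativeProofs
import Literature.NumberTheory.EllipticCurves.OrdinaryReductionTateModuleProofs
import Literature.NumberTheory.EllipticCurves.MultiplicativeInertiaLineProofs
import Literature.NumberTheory.EllipticCurves.TateCurve.InertiaTorsionOfTateParameterPower
import HarnessLib

/-!
# STUB-IDEAS `stub_liftFive` — ideator k = 3 (FAMILY 3, PROBE THE EXTREMES), GEN 7 companion

Crux `Summit.ABC.ABC.Theses.DefiniteXi.FreyModularity` (stmt-ABC-11340), skeleton `Lines/Sketch.lean`,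
stub `stub_liftFive` (Diamond 1996 Thm 5.3 = `CDT_theorem_7_2_2 ∩ {25 ∤ N}`).  Gen 6 of this slot
(`STUB_IDEAS_stub_liftFive_3g6.lean`) left the two LOCAL inputs of the multiplicative corner as (M)-size
sorried shapes: P2 `MultiplicativeOrdinaryFiltrationShape` (ordinary line of `V_pE` at a multiplicative
`v ∣ p`) and P4 `TypeAOffFiveShape` (unipotent inertia at a multiplicative `v ∤ p`).  This file cuts both
into ONE-CYCLE helper lemmas over the tree's PROVED Tate data, and PROVES the two assemblies:

* §1 `L6`  torsion-level variant of `RationalTateModule.baseChange_tateRepresentation_sub_mem_ker` (proved);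
* §2 `L1`, `L7` — the two genuine one-cycle stubs (sorried, statements elaborate), `L2`, `L3`, `L5` (proved glue);
* §3 P2 ASSEMBLED: `multiplicativeOrdinaryFiltration_of_L1_L7 : L1 → L7 → MultiplicativeOrdinaryFiltrationShape`
  — Step 7 of `ellipticOrdinaryReduction_tateModule_filtration_holds` transplanted to the quotient
  `E(K̄_v)/E₁(K̄_v)` in place of `Ẽ(k̄_w)`;
* §4 P4 PROVED outright: `M1` (local, level `pⁿ`, from `exists_tateBasis_localPoints_of_hasMultiplicativeReductionAt`),
  `M1'` (global transport, template `smul_eq_of_mem_inertia_of_pow_eq_tateParameter_of_nsmul_eq_zero`),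
  `M2` (limit in `T_pE`), `typeAOffFive : TypeAOffFiveShape`.

Shapes are VERBATIM copies of gen 6 (so `Iff.rfl` against that file).  Literature-only imports
(`lean check --no-snap`).  Nothing here is a tree theorem; provers port §1–§4 to
`Literature/NumberTheory/EllipticCurves/MultiplicativeOrdinaryFiltrationProofs.lean` (`--supports stmt-ABC-11340`).
-/

noncomputable section

open scoped Classical NNReal NumberField AddSubgroup TensorProduct Pointwise
open NumberField IsDedekindDomain Field
open Literature.NumberTheory.EllipticCurves Literature.NumberTheory.EllipticCurves.TateCurve
open Literature.NumberTheory.GaloisRepresentations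
open WeierstrassCurve IsDedekindDomain.HeightOneSpectrum

namespace Summit.ABC.ABC.Cruxes.FreyModularity.StubIdeas.LiftFive3g7

/-- `5` is prime (instance used by the `p = 5` shapes, as in gen 6). -/
instance instFactPrimeFive : Fact (Nat.Prime 5) := ⟨by norm_num⟩

/-! ## §0 The two gen-6 shapes (verbatim) -/

/-- P2 shape (gen 6, verbatim). [cite: SilvermanATAEC1994, V §5 Thm. 5.3, Cor. 5.4; V §6 Prop. 6.1] -/
def MultiplicativeOrdinaryFiltrationShape : Prop :=
  ∀ {K : Type} [Field K] [NumberField K] (W : WeierstrassCurve K) [W.IsElliptic]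
    (p : ℕ) [Fact p.Prime] (v : HeightOneSpectrum (𝓞 K)),
    (p : 𝓞 K) ∈ v.asIdeal → W.HasMultiplicativeReductionAt v →
    ∃ L : Submodule ℚ_[p] (W.rationalTateModule p),
      Module.finrank ℚ_[p] L = 1 ∧
      (∀ (τ : absoluteGaloisGroup (v.adicCompletion K)), ∀ x ∈ L,
        W.rationalGaloisRepTate p (absGaloisRestrict K (v.adicCompletion K) τ) x ∈ L) ∧
      (∀ τ ∈ absInertia (v.adicCompletion K), ∀ x ∈ L,
        W.rationalGaloisRepTate p (absGaloisRestrict K (v.adicCompletion K) τ) x =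
          (((GaloisRep.cyclotomicCharacter (v.adicCompletion K) p τ : ℤ_[p]ˣ) : ℤ_[p]) : ℚ_[p]) • x) ∧
      (∀ τ ∈ absInertia (v.adicCompletion K), ∀ x : W.rationalTateModule p,
        W.rationalGaloisRepTate p (absGaloisRestrict K (v.adicCompletion K) τ) x - x ∈ L)

/-- P4 shape (gen 6, verbatim). [cite: SilvermanATAEC1994, V.4–V.5 and Exercise 5.13(b)] -/
def TypeAOffFiveShape : Prop :=
  ∀ (W : WeierstrassCurve ℚ) [W.IsElliptic] (v : HeightOneSpectrum (𝓞 ℚ)),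
    ((5 : ℕ) : 𝓞 ℚ) ∉ v.asIdeal → W.HasMultiplicativeReductionAt v →
    ∀ 𝔓 ∈ v.primesAbove, ∀ σ ∈ 𝔓.inertia (absoluteGaloisGroup ℚ),
      (W.galoisRepTate 5 σ - 1) * (W.galoisRepTate 5 σ - 1) = 0

/-! ## §1 L6 — torsion-level kernel lemma (general additive groups; proved) -/

section L6

variable {A : Type} [AddCommGroup A] {B : Type} [AddCommGroup B] {p : ℕ} [Fact p.Prime]
  (f : A →+ B) {G : Type*} [Monoid G] [DistribMulAction G A]

/-- `T_p f (τ • y) = T_p f y` as soon as `f (τ • x) = f x` on every `A[pⁿ]` (only the `p`-power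
torsion of `A` is seen by `T_p`). [folklore] -/
theorem tateModule_map_smul_of_invariant_on_torsionBy (τ : G)
    (hf : ∀ n : ℕ, ∀ x ∈ A[(p ^ n : ℕ)], f (τ • x) = f x) (y : TateModule A p) :
    TateModule.map p f (τ • y) = TateModule.map p f y :=
  TateModule.ext fun n ↦ by
    rw [TateModule.proj_map, TateModule.proj_smul_of_distribMulAction, TateModule.proj_map]
    exact hf n _ (TateModule.proj_mem_torsionBy n y)

/-- **L6.** `τ • x - x ∈ ker V_p f` when `f (τ • a) = f a` for all `a ∈ A[pⁿ]`, all `n` — the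
torsion-level variant of `RationalTateModule.baseChange_tateRepresentation_sub_mem_ker` (whose hypothesis
`∀ a, f (τ • a) = f a` FAILS for `f = (E(K̄_v) → E(K̄_v)/E₁)`, tame inertia moving `Ψ(π^{1/n})`).
[cite: Greenberg1991, §2 (p. 214)] -/
theorem baseChange_tateRepresentation_sub_mem_ker_of_torsionBy (τ : G)
    (hf : ∀ n : ℕ, ∀ x ∈ A[(p ^ n : ℕ)], f (τ • x) = f x) (x : ℚ_[p] ⊗[ℤ_[p]] TateModule A p) :
    (tateRepresentation G A p τ).baseChange ℚ_[p] x - x ∈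
      LinearMap.ker ((TateModule.map p f).baseChange ℚ_[p]) := by
  rw [LinearMap.mem_ker, map_sub, sub_eq_zero]
  induction x using TensorProduct.induction_on with
  | zero => simp only [map_zero]
  | tmul c y =>
    rw [LinearMap.baseChange_tmul, LinearMap.baseChange_tmul, LinearMap.baseChange_tmul,
      tateRepresentation_apply_apply, tateModule_map_smul_of_invariant_on_torsionBy f τ hf]
  | add x y hx hy => simp only [map_add, hx, hy]

end L6

/-! ## §2 The local helper lemmas at a multiplicative `v ∣ p` -/

section Local

variable {K : Type} [Field K] [NumberField K] (W : WeierstrassCurve K) [W.IsElliptic]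
  {p : ℕ} [hp : Fact p.Prime] {v : HeightOneSpectrum (𝓞 K)}

/-- **L1 (one-cycle stub, S/M).** `#E₁(K̄_v)[pⁿ] = pⁿ` at a multiplicative `v ∣ p`.  From the Tate datum
`TateCurve.exists_twistedTateUniformisation_localKernelOfReduction_iff W v hmult` (`Ψ : K̄_vˣ ↠ E(K̄_v)`,
`ker Ψ = q^ℤ`, `E₁ = Ψ(1 + 𝔪)`): `u ↦ Ψ(u)` is a bijection `μ_{pⁿ}(K̄_v) ≃ E₁[pⁿ]` — well defined since
at `v ∣ p` every `p`-power root of unity is a principal unit (`WeierstrassCurve.spectralValuation_sub_one_lt_one_of_pow`),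
injective since `q^ℤ ∩ 𝓞^× = 1`, onto since `Ψ(u) ∈ E₁[pⁿ]` forces `u^{pⁿ} ∈ q^ℤ ∩ (1+𝔪) = 1`; and
`#μ_{pⁿ}(K̄_v) = pⁿ` (`IsAlgClosed`, char `0`). [cite: SilvermanATAEC1994, §V.4 (PDF pp. 399–401), Thm. V.5.3] -/
theorem natCard_torsionBy_localKernelOfReduction_eq (hpv : ((p : ℕ) : 𝓞 K) ∈ v.asIdeal)
    (hmult : W.HasMultiplicativeReductionAt v) (n : ℕ) :
    Nat.card ((W.localKernelOfReduction v)[(p ^ n : ℕ)]) = p ^ n := by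
  sorry

/-- **L7 (one-cycle stub, S/M).** At a multiplicative `v ∣ p` the inertia group acts trivially on
`E(K̄_v)[p^∞]` MODULO `E₁(K̄_v)`: `τ • Q - Q ∈ E₁` for `τ ∈ absInertia K_v`, `pⁿ Q = O`.  From the Tate datum:
`Q = Ψ(u)`, `u^{pⁿ} = q^m`; `τ • Ψ(u) = χ(τ) Ψ(τu)` with `χ(τ) = 1` on inertia
(`TateCurve.toAlgEquiv_eq_of_mem_inertia_of_sq_eq_gamma` + `inertia_eq_absInertia`); `(τu/u)^{pⁿ} = 1`, so
`τu/u` is a `p`-power root of unity, hence a principal unit at `v ∣ p`, hence `Ψ(τu/u) ∈ E₁`.  FALSE off the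
`p`-power torsion (tame inertia moves `Ψ(π^{1/ℓ})`), which is why L6 is needed. [cite: SilvermanATAEC1994, Lemma V.5.2 (c), Thm. V.5.3 (PDF pp. 407–410)] -/
theorem smul_sub_mem_localKernelOfReduction_of_mem_absInertia (hpv : ((p : ℕ) : 𝓞 K) ∈ v.asIdeal)
    (hmult : W.HasMultiplicativeReductionAt v) {τ : absoluteGaloisGroup (v.adicCompletion K)}
    (hτ : τ ∈ absInertia (v.adicCompletion K)) {n : ℕ} {Q : localPoints W (v.adicCompletion K)}
    (hQ : p ^ n • Q = 0) : τ • Q - Q ∈ W.localKernelOfReduction v := by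
  sorry

/-- **L2 (proved).** A class of `E(K̄_v)/E₁` killed by `pⁿ` has a `pⁿ`-torsion representative — from
(div₁) `exists_nsmul_pow_eq_of_mem_localKernelOfReduction_of_hasMultiplicativeReductionAt`. [folklore] -/
theorem exists_torsion_sub_mem_localKernelOfReduction (hpv : ((p : ℕ) : 𝓞 K) ∈ v.asIdeal)
    (hmult : W.HasMultiplicativeReductionAt v) (n : ℕ) {Q : localPoints W (v.adicCompletion K)}
    (hQ : p ^ n • Q ∈ W.localKernelOfReduction v) :
    ∃ Q' : localPoints W (v.adicCompletion K),
      p ^ n • Q' = 0 ∧ Q' - Q ∈ W.localKernelOfReduction v := by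
  obtain ⟨Z, hZ, hZQ⟩ :=
    W.exists_nsmul_pow_eq_of_mem_localKernelOfReduction_of_hasMultiplicativeReductionAt hpv hmult n hQ
  refine ⟨Q - Z, ?_, ?_⟩
  · rw [smul_sub, hZQ, sub_self]
  · rw [sub_sub_cancel_left]
    exact neg_mem hZ

/-- **L3 (proved from L1 + L2).** `#(E(K̄_v)/E₁)[pⁿ] = pⁿ`: `#E₁[pⁿ] · #(E/E₁)[pⁿ] = #E[pⁿ] = p²ⁿ`
(`TateModule.card_ker_torsionBy_mul_card`, surjectivity on torsion = L2). [folklore] -/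
theorem natCard_torsionBy_quotient_localKernelOfReduction_eq (hpv : ((p : ℕ) : 𝓞 K) ∈ v.asIdeal)
    (hmult : W.HasMultiplicativeReductionAt v)
    (hL1 : ∀ n : ℕ, Nat.card ((W.localKernelOfReduction v)[(p ^ n : ℕ)]) = p ^ n) (n : ℕ) :
    Nat.card ((localPoints W (v.adicCompletion K) ⧸ W.localKernelOfReduction v)[(p ^ n : ℕ)]) =
      p ^ n := by
  haveI : CharZero (AlgebraicClosure (v.adicCompletion K)) :=
    charZero_of_injective_algebraMap (algebraMap K (AlgebraicClosure (v.adicCompletion K))).injective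
  have hp0 : p ^ n ≠ 0 := pow_ne_zero n hp.out.ne_zero
  have hcardL : Nat.card ((localPoints W (v.adicCompletion K))[(p ^ n : ℕ)]) = p ^ n * p ^ n := by
    have h := card_torsionBy_eq_sq (E := W.baseChange (AlgebraicClosure (v.adicCompletion K)))
      (n := p ^ n) (by exact_mod_cast hp0)
    rw [sq] at h
    exact h
  have hsurj : ∀ y ∈ (localPoints W (v.adicCompletion K) ⧸ W.localKernelOfReduction v)[(p ^ n : ℕ)],
      ∃ x ∈ (localPoints W (v.adicCompletion K))[(p ^ n : ℕ)],
        QuotientAddGroup.mk' (W.localKernelOfReduction v) x = y := by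
    intro y hy
    obtain ⟨Q, rfl⟩ := QuotientAddGroup.mk'_surjective (W.localKernelOfReduction v) y
    have hQ : p ^ n • Q ∈ W.localKernelOfReduction v := by
      rw [← QuotientAddGroup.eq_zero_iff, QuotientAddGroup.mk_nsmul]
      have h := AddSubgroup.torsionBy.nsmul_iff.mp hy
      rwa [QuotientAddGroup.mk'_apply] at h
    obtain ⟨Q', hQ', hQ'Q⟩ := exists_torsion_sub_mem_localKernelOfReduction W hpv hmult n hQ
    refine ⟨Q', AddSubgroup.torsionBy.nsmul_iff.mpr hQ', ?_⟩
    rw [QuotientAddGroup.mk'_apply, QuotientAddGroup.mk'_apply, QuotientAddGroup.eq_iff_sub_mem]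
    exact hQ'Q
  have hmul := TateModule.card_ker_torsionBy_mul_card
    (QuotientAddGroup.mk' (W.localKernelOfReduction v)) (p ^ n) hsurj
  rw [QuotientAddGroup.ker_mk', hL1 n, hcardL] at hmul
  exact Nat.eq_of_mul_eq_mul_left (Nat.pos_of_ne_zero hp0) hmul

/-- **L5 (proved from L2 + counting).** `f = (E(K̄) → E(K̄_v) → E(K̄_v)/E₁)` maps `E[pⁿ]` ONTO
`(E(K̄_v)/E₁)[pⁿ]` (all torsion of `E(K̄_v)` is algebraic: `exists_mem_torsionBy_eq_of_injective`). [folklore] -/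
theorem exists_torsionBy_comp_pointsMap_eq (hpv : ((p : ℕ) : 𝓞 K) ∈ v.asIdeal)
    (hmult : W.HasMultiplicativeReductionAt v) (n : ℕ)
    (y : localPoints W (v.adicCompletion K) ⧸ W.localKernelOfReduction v)
    (hy : y ∈ (localPoints W (v.adicCompletion K) ⧸ W.localKernelOfReduction v)[(p ^ n : ℕ)]) :
    ∃ x ∈ (geomPoints W)[(p ^ n : ℕ)],
      (QuotientAddGroup.mk' (W.localKernelOfReduction v)).comp (pointsMap W (v.adicCompletion K)) x =
        y := by
  haveI : CharZero (AlgebraicClosure (v.adicCompletion K)) :=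
    charZero_of_injective_algebraMap (algebraMap K (AlgebraicClosure (v.adicCompletion K))).injective
  haveI : CharZero (AlgebraicClosure K) :=
    charZero_of_injective_algebraMap (algebraMap K (AlgebraicClosure K)).injective
  have hp0 : p ^ n ≠ 0 := pow_ne_zero n hp.out.ne_zero
  have hA : Nat.card ((geomPoints W)[(p ^ n : ℕ)]) = (p ^ n) ^ 2 :=
    card_torsionBy_eq_sq (E := W.baseChange (AlgebraicClosure K)) (n := p ^ n) (by exact_mod_cast hp0)
  have hcardL : Nat.card ((localPoints W (v.adicCompletion K))[(p ^ n : ℕ)]) = (p ^ n) ^ 2 :=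
    card_torsionBy_eq_sq (E := W.baseChange (AlgebraicClosure (v.adicCompletion K)))
      (n := p ^ n) (by exact_mod_cast hp0)
  obtain ⟨Q, rfl⟩ := QuotientAddGroup.mk'_surjective (W.localKernelOfReduction v) y
  have hQ : p ^ n • Q ∈ W.localKernelOfReduction v := by
    rw [← QuotientAddGroup.eq_zero_iff, QuotientAddGroup.mk_nsmul]
    have h := AddSubgroup.torsionBy.nsmul_iff.mp hy
    rwa [QuotientAddGroup.mk'_apply] at h
  obtain ⟨Q', hQ', hQ'Q⟩ := exists_torsion_sub_mem_localKernelOfReduction W hpv hmult n hQ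
  haveI : Finite ((localPoints W (v.adicCompletion K))[(p ^ n : ℕ)]) :=
    Nat.finite_of_card_ne_zero (by rw [hcardL]; exact pow_ne_zero 2 hp0)
  obtain ⟨x, hx, hxQ⟩ := exists_mem_torsionBy_eq_of_injective (pointsMap W (v.adicCompletion K))
    (pointsMapOfEmb_injective W (closureEmb (K := K) (v.adicCompletion K))) (p ^ n)
    (le_of_eq (by rw [hcardL, hA])) Q' (AddSubgroup.torsionBy.nsmul_iff.mpr hQ')
  refine ⟨x, hx, ?_⟩
  rw [AddMonoidHom.comp_apply, hxQ, QuotientAddGroup.mk'_apply, QuotientAddGroup.mk'_apply,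
    QuotientAddGroup.eq_iff_sub_mem]
  exact hQ'Q

end Local

/-! ## §3 P2 assembled from L1 and L7 (Step 7 of the good-ordinary proof, with `Ẽ(k̄)` replaced by `E(K̄_v)/E₁`) -/

/-- The two open inputs of P2, as named facts (each = one helper above, universally quantified). -/
def L1Statement : Prop :=
  ∀ {K : Type} [Field K] [NumberField K] (W : WeierstrassCurve K) [W.IsElliptic]
    (p : ℕ) [Fact p.Prime] (v : HeightOneSpectrum (𝓞 K)),
    ((p : ℕ) : 𝓞 K) ∈ v.asIdeal → W.HasMultiplicativeReductionAt v →
    ∀ n : ℕ, Nat.card ((W.localKernelOfReduction v)[(p ^ n : ℕ)]) = p ^ n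

/-- See `smul_sub_mem_localKernelOfReduction_of_mem_absInertia`. -/
def L7Statement : Prop :=
  ∀ {K : Type} [Field K] [NumberField K] (W : WeierstrassCurve K) [W.IsElliptic]
    (p : ℕ) [Fact p.Prime] (v : HeightOneSpectrum (𝓞 K)),
    ((p : ℕ) : 𝓞 K) ∈ v.asIdeal → W.HasMultiplicativeReductionAt v →
    ∀ τ ∈ absInertia (v.adicCompletion K), ∀ (n : ℕ) (Q : localPoints W (v.adicCompletion K)),
      p ^ n • Q = 0 → τ • Q - Q ∈ W.localKernelOfReduction v

/-- **P2 ASSEMBLY (proved): `L1 → L7 → MultiplicativeOrdinaryFiltrationShape`.**  `f := (E(K̄) → E(K̄_v)/E₁)`,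
`L := ker V_p f`; `finrank L = 2 - 1` (`RationalTateModule.finrank_ker_baseChange_map`, counts
`#E[pⁿ] = p²ⁿ`, L3, L5); `L` is `Γ_{K_v}`-stable (`E₁` is, `smul_mem_localKernelOfReduction_iff`); inertia
acts trivially on `V/L` (L6 + L7); and by `χ_p` on `L` for free from `det = χ_p`
(`LinearMap.eq_det_smul_of_mem_of_finrank_eq_one`). [cite: SilvermanATAEC1994, V §5 Thm. 5.3] [cite: Greenberg1991, §2 (p. 214)] -/
theorem multiplicativeOrdinaryFiltration_of_L1_L7 (hL1 : L1Statement) (hL7 : L7Statement) :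
    MultiplicativeOrdinaryFiltrationShape := by
  intro K _ _ W _ p hp v hpv hmult
  haveI : CharZero (AlgebraicClosure K) :=
    charZero_of_injective_algebraMap (algebraMap K (AlgebraicClosure K)).injective
  -- the reduction-type map `f : E(K̄) → E(K̄_v)/E₁(K̄_v)`
  set f : geomPoints W →+ localPoints W (v.adicCompletion K) ⧸ W.localKernelOfReduction v :=
    (QuotientAddGroup.mk' (W.localKernelOfReduction v)).comp (pointsMap W (v.adicCompletion K))
    with hf
  have hf0 : ∀ a : geomPoints W, f a = 0 ↔ pointsMap W (v.adicCompletion K) a ∈ W.localKernelOfReduction v := by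
    intro a
    rw [hf, AddMonoidHom.comp_apply, QuotientAddGroup.mk'_apply, QuotientAddGroup.eq_zero_iff]
  have hfσ : ∀ (σ : absoluteGaloisGroup (v.adicCompletion K)) (a : geomPoints W),
      pointsMap W (v.adicCompletion K) (absGaloisRestrict K (v.adicCompletion K) σ • a) =
        σ • pointsMap W (v.adicCompletion K) a := by
    intro σ a
    rw [← resGal_eq_absGaloisRestrict, pointsMap_smul]
  -- Step 5': `ker f` is `Γ_{K_v}`-stable, inertia is trivial on the torsion of the target
  have hstab : ∀ (σ : absoluteGaloisGroup (v.adicCompletion K)) (a : geomPoints W),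
      f a = 0 → f (absGaloisRestrict K (v.adicCompletion K) σ • a) = 0 := by
    intro σ a ha
    rw [hf0] at ha ⊢
    rw [hfσ]
    exact (W.smul_mem_localKernelOfReduction_iff v σ _).mpr ha
  have hinv : ∀ τ ∈ absInertia (v.adicCompletion K), ∀ n : ℕ, ∀ a ∈ (geomPoints W)[(p ^ n : ℕ)],
      f (absGaloisRestrict K (v.adicCompletion K) τ • a) = f a := by
    intro τ hτ n a ha
    rw [hf, AddMonoidHom.comp_apply, AddMonoidHom.comp_apply, hfσ, QuotientAddGroup.mk'_apply,
      QuotientAddGroup.mk'_apply, QuotientAddGroup.eq_iff_sub_mem]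
    refine hL7 W p v hpv hmult τ hτ n _ ?_
    rw [← map_nsmul, AddSubgroup.torsionBy.nsmul_iff.mp ha, map_zero]
  -- Step 6': counting
  have hp0 : ∀ n : ℕ, p ^ n ≠ 0 := fun n ↦ pow_ne_zero n hp.out.ne_zero
  have hA : ∀ n, Nat.card ((geomPoints W)[(p ^ n : ℕ)]) = p ^ (2 * n) := by
    intro n
    have h := card_torsionBy_eq_sq (E := W.baseChange (AlgebraicClosure K)) (n := p ^ n)
      (by exact_mod_cast hp0 n)
    rw [← pow_mul, mul_comm] at h
    exact h
  have hB : ∀ n, Nat.card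
      ((localPoints W (v.adicCompletion K) ⧸ W.localKernelOfReduction v)[(p ^ n : ℕ)]) = p ^ (1 * n) := by
    intro n
    rw [one_mul]
    exact natCard_torsionBy_quotient_localKernelOfReduction_eq W hpv hmult (hL1 W p v hpv hmult) n
  have hsurj : ∀ n, ∀ y ∈ ((localPoints W (v.adicCompletion K) ⧸ W.localKernelOfReduction v)[(p ^ n : ℕ)]),
      ∃ x ∈ (geomPoints W)[(p ^ n : ℕ)], f x = y :=
    fun n y hy ↦ exists_torsionBy_comp_pointsMap_eq W hpv hmult n y hy
  -- Step 7 (verbatim): the line `F¹ = ker V_p(f)` and the four clauses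
  let Lk : Submodule ℚ_[p] (W.rationalTateModule p) :=
    LinearMap.ker ((TateModule.map p f).baseChange ℚ_[p])
  have h1 : Module.finrank ℚ_[p] Lk = 1 :=
    RationalTateModule.finrank_ker_baseChange_map (f := f) hA hB hsurj
  have h2 : ∀ (τ : absoluteGaloisGroup (v.adicCompletion K)), ∀ x ∈ Lk,
      W.rationalGaloisRepTate p (absGaloisRestrict K (v.adicCompletion K) τ) x ∈ Lk :=
    fun τ x hx ↦ RationalTateModule.baseChange_tateRepresentation_mem_ker_of_ker_stable f
      (absGaloisRestrict K (v.adicCompletion K) τ) (hstab τ) hx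
  have h4 : ∀ τ ∈ absInertia (v.adicCompletion K), ∀ x : W.rationalTateModule p,
      W.rationalGaloisRepTate p (absGaloisRestrict K (v.adicCompletion K) τ) x - x ∈ Lk :=
    fun τ hτ x ↦ baseChange_tateRepresentation_sub_mem_ker_of_torsionBy f
      (absGaloisRestrict K (v.adicCompletion K) τ) (hinv τ hτ) x
  haveI : Module.Finite ℚ_[p] (W.rationalTateModule p) :=
    module_finite_rationalTateModule_holds W p
  haveI : NeZero (p : K) := ⟨Nat.cast_ne_zero.mpr hp.out.ne_zero⟩
  have h3 : ∀ τ ∈ absInertia (v.adicCompletion K), ∀ x ∈ Lk,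
      W.rationalGaloisRepTate p (absGaloisRestrict K (v.adicCompletion K) τ) x =
        (((GaloisRep.cyclotomicCharacter (v.adicCompletion K) p τ : ℤ_[p]ˣ) : ℤ_[p]) :
          ℚ_[p]) • x := by
    intro τ hτ x hx
    have hdet : LinearMap.det
        (W.rationalGaloisRepTate p (absGaloisRestrict K (v.adicCompletion K) τ) :
          W.rationalTateModule p →ₗ[ℚ_[p]] W.rationalTateModule p) =
        (((GaloisRep.cyclotomicCharacter K p (absGaloisRestrict K (v.adicCompletion K) τ) :
          ℤ_[p]ˣ) : ℤ_[p]) : ℚ_[p]) :=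
      det_rationalTateRepresentation_eq_cyclotomicCharacter W p _
    rw [LinearMap.eq_det_smul_of_mem_of_finrank_eq_one Lk h1 _ (h2 τ) (h4 τ hτ) x hx, hdet,
      cyclotomicCharacter_absGaloisRestrict]
  exact ⟨Lk, h1, h2, h3, h4⟩

/-- P2 modulo the two one-cycle stubs L1, L7 of §2 (sorries live only there). -/
theorem multiplicativeOrdinaryFiltration : MultiplicativeOrdinaryFiltrationShape := by
  refine multiplicativeOrdinaryFiltration_of_L1_L7 ?_ ?_
  · intro K _ _ W _ p _ v hpv hmult n
    exact natCard_torsionBy_localKernelOfReduction_eq W hpv hmult n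
  · intro K _ _ W _ p _ v hpv hmult τ hτ n Q hQ
    exact smul_sub_mem_localKernelOfReduction_of_mem_absInertia W hpv hmult hτ hQ

/-! ## §4 P4 proved: unipotent inertia at a multiplicative `v ∤ p` -/

section OffP

variable {K : Type} [Field K] [NumberField K] (W : WeierstrassCurve K) [W.IsElliptic]
  {p : ℕ} [hp : Fact p.Prime] {v : HeightOneSpectrum (𝓞 K)}

/-- **M1 (local, level `pⁿ`; proved).** At a multiplicative `v ∤ p`, every inertia element `τ ∈ I_𝔐`
satisfies `(τ - 1)² = 0` on `E(K̄_v)[pⁿ]`: `Q = aP₁ + bP₂`, `τQ - Q = bm·P₁` is fixed by `τ`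
(`exists_tateBasis_localPoints_of_hasMultiplicativeReductionAt`). [cite: SilvermanATAEC1994, V.4–V.5, Exercise 5.13(b)] -/
theorem smul_smul_sub_eq_of_mem_inertia (hmult : W.HasMultiplicativeReductionAt v)
    (hpv : (p : 𝓞 K) ∉ v.asIdeal) {𝔐 : Ideal v.localAbsIntegers} (h𝔐 : 𝔐 ∈ v.localPrimesAbove)
    {τ : absoluteGaloisGroup (v.adicCompletion K)}
    (hτ : τ ∈ 𝔐.inertia (absoluteGaloisGroup (v.adicCompletion K)))
    {n : ℕ} {Q : localPoints W (v.adicCompletion K)} (hQ : p ^ n • Q = 0) :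
    τ • (τ • Q - Q) = τ • Q - Q := by
  rcases Nat.eq_zero_or_pos n with rfl | hn
  · rw [pow_zero, one_smul] at hQ
    rw [hQ, smul_zero, sub_zero, smul_zero]
  obtain ⟨P₁, P₂, -, -, -, hgen, hI⟩ :=
    W.exists_tateBasis_localPoints_of_hasMultiplicativeReductionAt hmult hp.out hpv hn
      (coe_spectralValuation v) h𝔐
  obtain ⟨a, b, rfl⟩ := hgen Q hQ
  obtain ⟨h₁, m, h₂⟩ := hI τ hτ
  have hτ₂ : τ • P₂ = P₂ + m • P₁ := by rw [← h₂, add_sub_cancel]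
  have key : τ • (a • P₁ + b • P₂) - (a • P₁ + b • P₂) = (b * m) • P₁ := by
    rw [smul_add, smul_comm τ a P₁, smul_comm τ b P₂, h₁, hτ₂, smul_add, mul_smul]
    abel
  rw [key, smul_comm τ (b * m) P₁, h₁]

/-- **M1' (global transport; proved).** The same for `τ ∈ I_𝔓 ≤ Γ_K`, `𝔓` over `v`, on `E(K̄)[pⁿ]` —
template `smul_eq_of_mem_inertia_of_pow_eq_tateParameter_of_nsmul_eq_zero` (lift `τ` to `I_𝔐 ≤ Γ_{K_v}`
along an embedding cutting out `𝔓`, `exists_mem_inertia_apply_eq_holds`). [cite: NeukirchANT1999, Ch. II §9 Prop. (9.6)] -/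
theorem smul_smul_sub_eq_of_mem_inertia_primesAbove (hmult : W.HasMultiplicativeReductionAt v)
    (hpv : (p : 𝓞 K) ∉ v.asIdeal) {𝔓 : Ideal (absIntegers (𝓞 K) K)} (h𝔓 : 𝔓 ∈ v.primesAbove)
    {τ : absoluteGaloisGroup K} (hτ : τ ∈ 𝔓.inertia (absoluteGaloisGroup K))
    {n : ℕ} {P : geomPoints W} (hP : p ^ n • P = 0) : τ • (τ • P - P) = τ • P - P := by
  obtain ⟨𝔐, h𝔐⟩ := v.localPrimesAbove_nonempty
  obtain ⟨g, hg⟩ := HeightOneSpectrum.exists_smul_eq_of_mem_primesAbove_holds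
    (HeightOneSpectrum.primeBelow_mem_primesAbove
      (ι := closureEmb (K := K) (v.adicCompletion K)) h𝔐) h𝔓
  set ι : AlgebraicClosure K →ₐ[K] AlgebraicClosure (v.adicCompletion K) :=
    (closureEmb (K := K) (v.adicCompletion K)).comp
      ((show AlgebraicClosure K ≃ₐ[K] AlgebraicClosure K from g⁻¹) :
        AlgebraicClosure K →ₐ[K] AlgebraicClosure K) with hι
  have h1 : 𝔓 = v.primeBelow ι 𝔐 := by
    rw [hι, HeightOneSpectrum.primeBelow_comp, ← hg]
    exact congrArg (· • _) (inv_inv g).symm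
  rw [h1] at hτ
  obtain ⟨σ, hσI, hσ⟩ :=
    IsDedekindDomain.HeightOneSpectrum.exists_mem_inertia_apply_eq_holds v ι h𝔐 hτ
  have hres : resGalOfEmb ι σ = τ := resGalOfEmb_eq_of_apply_eq ι hσ
  have hsmul : ∀ R : geomPoints W, pointsMapOfEmb W ι (τ • R) = σ • pointsMapOfEmb W ι R := by
    intro R
    rw [← hres]
    exact pointsMapOfEmb_smul W ι σ R
  apply pointsMapOfEmb_injective W ι
  rw [hsmul, map_sub, hsmul]
  exact smul_smul_sub_eq_of_mem_inertia W hmult hpv h𝔐 hσI (Q := pointsMapOfEmb W ι P)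
    (by rw [← map_nsmul, hP, map_zero])

/-- **M2 (limit; proved).** `(ρ_{E,p}(τ) - 1)² = 0` on `T_pE` for `τ ∈ I_𝔓`, `𝔓 ∣ v`, `v ∤ p` multiplicative. [cite: SerreAbelianLadic1968, Ch. IV, A.1.2] -/
theorem galoisRepTate_sub_one_mul_self_eq_zero_of_mem_inertia (hmult : W.HasMultiplicativeReductionAt v)
    (hpv : (p : 𝓞 K) ∉ v.asIdeal) {𝔓 : Ideal (absIntegers (𝓞 K) K)} (h𝔓 : 𝔓 ∈ v.primesAbove)
    {τ : absoluteGaloisGroup K} (hτ : τ ∈ 𝔓.inertia (absoluteGaloisGroup K)) :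
    (W.galoisRepTate p τ - 1) * (W.galoisRepTate p τ - 1) = 0 := by
  refine LinearMap.ext fun a ↦ TateModule.ext fun n ↦ ?_
  rw [Module.End.mul_apply, LinearMap.sub_apply, LinearMap.sub_apply, Module.End.one_apply,
    Module.End.one_apply, galoisRepTate_apply_apply, galoisRepTate_apply_apply, LinearMap.zero_apply,
    map_zero, map_sub, TateModule.proj_smul_of_distribMulAction, map_sub,
    TateModule.proj_smul_of_distribMulAction, sub_eq_zero]
  exact smul_smul_sub_eq_of_mem_inertia_primesAbove W hmult hpv h𝔓 hτ (TateModule.pow_smul_proj n a)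

end OffP

/-- **P4 PROVED.** [cite: SilvermanATAEC1994, V.4–V.5 and Exercise 5.13(b)] -/
theorem typeAOffFive : TypeAOffFiveShape := by
  intro W _ v hv hmult 𝔓 h𝔓 σ hσ
  exact galoisRepTate_sub_one_mul_self_eq_zero_of_mem_inertia W (p := 5) hmult hv h𝔓 hσ

end Summit.ABC.ABC.Cruxes.FreyModularity.StubIdeas.LiftFive3g7

end
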